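import Literature.MathematicalPhysics.QuantumLattice.EmeryThreeBandCuO4ClusterDictionary
import HarnessLib

/-!
# THE RE-TILT LAW for cluster window certificates: a certificate at chemical-potential tilt `μ` IS a certificate at every other tilt `μ'`,
# with an explicit, SECTOR-WISE loss — for any general-pair cluster, and for the uniformly weighted `CuO₄` plus of the three-band model

Topic `Literature/MathematicalPhysics/QuantumLattice` (family `hubbard`; crew hubbard-fast S2 (iv) «three-band Emery boxes» × (ii) «T > 0»; seat hubbard-box-p1,
row «Lipschitz of certified objects in (U, μ) — the two-parameter tangent-plane lemma»). The typed three-band floor / thermal-cap words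
(`Downfold/EmeryClusterFloorSeam`, `Downfold/EmeryThermalCapFromFloorSeam`, hubbard-downfold-mod-4) consume ONE operator certificate per box corner,
`H^{w_M}_{W₅}[emeryInteraction (θ + μ·ε)] + G − q₀·1 ⪰ 0` (`ε` = the level direction `emeryAtomEps = (0,…,0,1,1,1,0,0,0)`: Cu, O_x, O_y site energies), produced
at the tilt `μ` the device owner chose (hubbard-box-p2's `kgp1x5_*` sector tables through `EmeryThreeBandCuO4ClusterDictionary`). Reading a cap at ANOTHER
reference level `μ'` so far needed a fresh certificate or the monotone (loss-free only upward, slack `≈ β(μ'−μ)·⟨N⟩`) level transfer. This file is the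
missing calculus — the certificate's dependence on the tilt is affine PER PARTICLE-NUMBER SECTOR, so a sector table re-tilts exactly up to the spread of the
site weights:

* §1 GENERAL-PAIR CLUSTERS (`generalPairHamiltonian τ υ ν` on any finite ordered site type; `hubbardOpenBoxGP a b` is the case `Fin a ×ₗ Fin b` by `rfl`):
  `generalPairHamiltonian_nu_add` (`h(ν + δ) = h(ν) + Σ_x δ_x (n_{x↑} + n_{x↓})`); the operator bracket `0 ⪯ Σ_x δ_x(n_{x↑}+n_{x↓}) − 2Σ_x min(0, δ_x)·1`
  (`posSemidef_sum_smul_siteNumber_sub`); the FLAT re-tilt `h(ν) + G − q·1 ⪰ 0 ⇒ h(ν+δ) + G − (q + 2Σ_x min(0,δ_x))·1 ⪰ 0` (`posSemidef_generalPair_retilt`);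
  the SECTOR re-tilt **`groundEnergy_generalPair_retilt_ge`**: for every `m ∈ ℝ` and `N ≤ 2|Λ|`,
  `E₀(h(ν+δ), N) ≥ E₀(h(ν), N) + m·N + 2Σ_x min(0, δ_x − m)` (the LP dual of «the `N` smallest of the `2|Λ|` numbers `δ_x`»; `m` free), and its table form
  `sectorFloors_generalPair_retilt` (a floor table `σ k ≤ E₀(h(ν), k)` becomes `σ k + s k ≤ E₀(h(ν+δ), k)` for any per-sector choice `m k`).
* §2 THE `CuO₄` PLUS with the uniform `(2ℤ)²` weight of mass `M` (`plusTau/plusUps/plusNu` of the dictionary): along the level direction the pair and repulsion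
  tables do not move and `plusNu (θ + c·ε) M = plusNu θ M + c·M·(½,½,1,½,½)` (`plusNu_add_smul_eps`); hence (**`groundEnergy_plusGP_retilt_ge`**)
  `E₀(h^G(θ + c·ε), k) ≥ E₀(h^G(θ), k) + max( (cM/2)·k + min(0, cM), cM·k − 4·max(0, cM) )` — i.e. `(cM/2)(k+2)` when lowering the level (`c ≤ 0`) and
  `(cM/2)(k + max(0, k−8))` when raising it (`c ≥ 0`, `M ≥ 0`) — and THE RE-TILTED WINDOW CERTIFICATE **`posSemidef_cuO4_uniform_retilt_of_sectorFloors`**: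
  a sector table `σ k ≤ E₀(hubbardOpenBoxGP 1 5 (plusTau θ M) (plusUps θ M) (plusNu θ M), k)` (`k ≤ 10`) and any `q` below the re-tilted table give
  `H^{w_M}_{W₅}[emeryInteraction (θ + c·ε)] + 0 − q·1 ⪰ 0`, the literal `hq` of the floor / thermal-cap doors at the NEW level. The flat operator form
  `posSemidef_cuO4_uniform_retilt` (`q ↦ q + 6M·min(0,c)`, any multiplier `G`, `M ≥ 0`) is the sector-free fallback.

Everything PROVED (0 sorry); no definition, no number. HONEST SCOPE: bookkeeping inequalities (number operators are `0 ⪯ n ⪯ 1` and diagonal); they move no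
router number by themselves — the gain is that ONE kernel sector table per corner now serves every reference level (e.g. La₂CuO₄ #18: the four corner tables
at tilts `(−17/2, −46/5, −9, −48/5)` re-tilted to the common level `−17/2` lower the box cap constant `54123877/1250000 → 48623877/1250000`, Summits side).

## Mathlib / tree search

REUSED: `generalPairHamiltonian`, `emeryAtomEps` (`EmeryThreeBandGeneralPairForm`); `plusTau/plusUps/plusNu`, `plusTau_symm`, `relabel_cuO4_uniform_emeryInteraction`,
`posSemidef_cuO4_uniform_add_zero_sub_of_gpSectorFloors` (`EmeryThreeBandCuO4ClusterDictionary`); `hubbardOpenBoxGP(_eq_generalPairHamiltonian)`,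
`posSemidef_relabel`, `relabel_symm_relabel` (`HubbardNNNHoppingClusterEmbedding`, `FockRelabel`); `LiebThm1.numberOp_eq_diagonal`, `LiebThm1.groundEnergy_le_re_expect`,
`LiebTwo.isNParticle_iff_totalNumber`, `ThermodynamicLimit.groundEnergySet_nonempty`, `card_orb`; Mathlib `Matrix.posSemidef_diagonal_iff`, `PosSemidef.add/smul/
dotProduct_mulVec_nonneg`, `smul_one_eq_diagonal`. `lean search 'retilt|nu_add|plusNu_add'` (2026-08-28): nothing.

## References

* R. B. Israel, Convexity in the Theory of Lattice Gases (1979), Thm. I.3.4 (pressure is convex and 1-Lipschitz in the interaction). [cite: Israel1979, Thm. I.3.4]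
* R. Valentí, J. Stolze, P. J. Hirschfeld, Phys. Rev. B 43 (1991) 13743, §II (weighted cluster bounds). [cite: ValentiStolzeHirschfeld1991, §II]
* I. Kull, N. Schuch, B. Dive, M. Navascués, Phys. Rev. X 14 (2024) 021008, §5.3 (sector certificates ⇒ operator inequality). [cite: KullEtAl2024, §5.3]
* H. Tasaki, Physics and Mathematics of Quantum Many-Body Systems (2020), §2.1 (variational principle). [cite: Tasaki2020, §2.1]
-/

noncomputable section

open scoped ComplexOrder BigOperators
open Finset

namespace Literature.MathematicalPhysics.QuantumLattice

open Matrix HubbardWave0 Literature.Probability.LatticeModels ThermodynamicLimit ClusterLowerBound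

/-! ### §1. General-pair clusters: the site-energy shift, the flat re-tilt, the sector re-tilt -/

section GeneralPair

variable {Λ₀ : Type*} [LinearOrder Λ₀] [Fintype Λ₀]

/-- A finite sum of positive semidefinite complex matrices is positive semidefinite. [folklore] -/
private theorem posSemidef_finsetSum_retilt {n : Type*} [Fintype n] {κ : Type*} (s : Finset κ) {A : κ → Matrix n n ℂ}
    (h : ∀ i ∈ s, (A i).PosSemidef) : (∑ i ∈ s, A i).PosSemidef :=
  Finset.sum_induction A (fun B : Matrix n n ℂ => B.PosSemidef) (fun _ _ ha hb => ha.add hb) Matrix.PosSemidef.zero h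

/-- **Shifting the site energies**: `h(τ, υ, ν + δ) = h(τ, υ, ν) + Σ_x δ_x (n_{x↑} + n_{x↓})`. [cite: ValentiStolzeHirschfeld1991, §II] -/
theorem generalPairHamiltonian_nu_add (τ : Λ₀ → Λ₀ → ℝ) (υ ν δ : Λ₀ → ℝ) :
    generalPairHamiltonian τ υ (ν + δ) =
      generalPairHamiltonian τ υ ν + ∑ x : Λ₀, ((δ x : ℝ) : ℂ) • (numberOp x 0 + numberOp x 1) := by
  unfold generalPairHamiltonian
  simp only [Pi.add_apply, Complex.ofReal_add, add_smul, Finset.sum_add_distrib]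
  abel

/-- **One site**: `0 ⪯ c·(n_{x↑} + n_{x↓}) − 2·min(0, c)·1` (both number operators are diagonal with entries in `{0, 1}`). [cite: Tasaki2020, §2.1] -/
theorem posSemidef_smul_siteNumber_sub (x : Λ₀) (c : ℝ) :
    (((c : ℝ) : ℂ) • (numberOp x 0 + numberOp x 1 : Matrix (Finset (Orb Λ₀)) (Finset (Orb Λ₀)) ℂ) -
      ((2 * min 0 c : ℝ) : ℂ) • (1 : Matrix (Finset (Orb Λ₀)) (Finset (Orb Λ₀)) ℂ)).PosSemidef := by
  rw [LiebThm1.numberOp_eq_diagonal, LiebThm1.numberOp_eq_diagonal, diagonal_add, ← diagonal_smul, smul_one_eq_diagonal,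
    diagonal_sub, posSemidef_diagonal_iff]
  intro s
  have key : ∀ a b : ℝ, (a = 1 ∨ a = 0) → (b = 1 ∨ b = 0) → (0 : ℝ) ≤ c * (a + b) - 2 * min 0 c := by
    intro a b ha hb
    rcases le_total 0 c with hc | hc
    · rw [min_eq_left hc]
      rcases ha with rfl | rfl <;> rcases hb with rfl | rfl <;> nlinarith
    · rw [min_eq_right hc]
      rcases ha with rfl | rfl <;> rcases hb with rfl | rfl <;> nlinarith
  rw [Pi.smul_apply, smul_eq_mul]
  by_cases h0 : orb x 0 ∈ s <;> by_cases h1 : orb x 1 ∈ s <;> simp only [h0, h1, if_true, if_false]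
  · exact_mod_cast key 1 1 (Or.inl rfl) (Or.inl rfl)
  · exact_mod_cast key 1 0 (Or.inl rfl) (Or.inr rfl)
  · exact_mod_cast key 0 1 (Or.inr rfl) (Or.inl rfl)
  · exact_mod_cast key 0 0 (Or.inr rfl) (Or.inr rfl)

/-- **The weighted number bracket**: `0 ⪯ Σ_x δ_x (n_{x↑} + n_{x↓}) − 2·(Σ_x min(0, δ_x))·1`. [cite: Tasaki2020, §2.1] -/
theorem posSemidef_sum_smul_siteNumber_sub (δ : Λ₀ → ℝ) :
    ((∑ x : Λ₀, ((δ x : ℝ) : ℂ) • (numberOp x 0 + numberOp x 1 : Matrix (Finset (Orb Λ₀)) (Finset (Orb Λ₀)) ℂ)) -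
      ((2 * ∑ x : Λ₀, min 0 (δ x) : ℝ) : ℂ) • (1 : Matrix (Finset (Orb Λ₀)) (Finset (Orb Λ₀)) ℂ)).PosSemidef := by
  have e : (∑ x : Λ₀, ((δ x : ℝ) : ℂ) • (numberOp x 0 + numberOp x 1 : Matrix (Finset (Orb Λ₀)) (Finset (Orb Λ₀)) ℂ)) -
      ((2 * ∑ x : Λ₀, min 0 (δ x) : ℝ) : ℂ) • (1 : Matrix (Finset (Orb Λ₀)) (Finset (Orb Λ₀)) ℂ) =
      ∑ x : Λ₀, ((((δ x : ℝ) : ℂ) • (numberOp x 0 + numberOp x 1 : Matrix (Finset (Orb Λ₀)) (Finset (Orb Λ₀)) ℂ)) -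
        ((2 * min 0 (δ x) : ℝ) : ℂ) • (1 : Matrix (Finset (Orb Λ₀)) (Finset (Orb Λ₀)) ℂ)) := by
    rw [Finset.sum_sub_distrib, ← Finset.sum_smul, Finset.mul_sum]
    push_cast
    rfl
  rw [e]
  exact posSemidef_finsetSum_retilt _ fun x _ => posSemidef_smul_siteNumber_sub x (δ x)

/-- **THE FLAT RE-TILT**: `h(τ,υ,ν) + G − q·1 ⪰ 0 ⇒ h(τ,υ,ν+δ) + G − (q + 2Σ_x min(0, δ_x))·1 ⪰ 0` for every multiplier `G` (the new operator is the old one plus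
the weighted number bracket). [cite: KullEtAl2024, §5.3] [cite: ValentiStolzeHirschfeld1991, §II] -/
theorem posSemidef_generalPair_retilt (τ : Λ₀ → Λ₀ → ℝ) (υ ν δ : Λ₀ → ℝ) {G : Matrix (Finset (Orb Λ₀)) (Finset (Orb Λ₀)) ℂ} {q : ℝ}
    (h : (generalPairHamiltonian τ υ ν + G - (q : ℂ) • (1 : Matrix (Finset (Orb Λ₀)) (Finset (Orb Λ₀)) ℂ)).PosSemidef) :
    (generalPairHamiltonian τ υ (ν + δ) + G -
      ((q + 2 * ∑ x : Λ₀, min 0 (δ x) : ℝ) : ℂ) • (1 : Matrix (Finset (Orb Λ₀)) (Finset (Orb Λ₀)) ℂ)).PosSemidef := by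
  have e : generalPairHamiltonian τ υ (ν + δ) + G -
      ((q + 2 * ∑ x : Λ₀, min 0 (δ x) : ℝ) : ℂ) • (1 : Matrix (Finset (Orb Λ₀)) (Finset (Orb Λ₀)) ℂ) =
      (generalPairHamiltonian τ υ ν + G - (q : ℂ) • (1 : Matrix (Finset (Orb Λ₀)) (Finset (Orb Λ₀)) ℂ)) +
        ((∑ x : Λ₀, ((δ x : ℝ) : ℂ) • (numberOp x 0 + numberOp x 1 : Matrix (Finset (Orb Λ₀)) (Finset (Orb Λ₀)) ℂ)) -
          ((2 * ∑ x : Λ₀, min 0 (δ x) : ℝ) : ℂ) • (1 : Matrix (Finset (Orb Λ₀)) (Finset (Orb Λ₀)) ℂ)) := by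
    rw [generalPairHamiltonian_nu_add, Complex.ofReal_add, add_smul]
    abel
  rw [e]
  exact h.add (posSemidef_sum_smul_siteNumber_sub δ)

/-- The total number is the sum of the site numbers: `N̂ = Σ_x (n_{x↑} + n_{x↓})`. [cite: Tasaki2020, §2.1] -/
theorem totalNumber_eq_sum_siteNumber :
    (totalNumber : Matrix (Finset (Orb Λ₀)) (Finset (Orb Λ₀)) ℂ) = ∑ x : Λ₀, (numberOp x 0 + numberOp x 1) := by
  unfold totalNumber
  exact Finset.sum_congr rfl fun x _ => by rw [Fin.sum_univ_two]

/-- **The weighted number on a sector** (the LP-dual form of «the `N` smallest weights»): for every unit `N`-particle vector `ψ` and every `m ∈ ℝ`,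
`m·N + 2Σ_x min(0, δ_x − m) ≤ Re⟨ψ, Σ_x δ_x (n_{x↑}+n_{x↓}) ψ⟩`. [cite: Tasaki2020, §2.1] -/
theorem re_expect_sum_smul_siteNumber_ge (δ : Λ₀ → ℝ) (m : ℝ) {N : ℕ} {ψ : Fock (Orb Λ₀)}
    (hψN : IsNParticle N ψ) (hψ1 : star ψ ⬝ᵥ ψ = 1) :
    m * N + 2 * ∑ x : Λ₀, min 0 (δ x - m) ≤
      (expect (∑ x : Λ₀, ((δ x : ℝ) : ℂ) • (numberOp x 0 + numberOp x 1 : Matrix (Finset (Orb Λ₀)) (Finset (Orb Λ₀)) ℂ)) ψ).re := by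
  set S : ℝ := 2 * ∑ x : Λ₀, min 0 (δ x - m) with hS
  set D : Matrix (Finset (Orb Λ₀)) (Finset (Orb Λ₀)) ℂ :=
    (∑ x : Λ₀, (((δ x - m : ℝ)) : ℂ) • (numberOp x 0 + numberOp x 1 : Matrix (Finset (Orb Λ₀)) (Finset (Orb Λ₀)) ℂ)) -
      ((S : ℝ) : ℂ) • (1 : Matrix (Finset (Orb Λ₀)) (Finset (Orb Λ₀)) ℂ) with hD
  have hDpsd : D.PosSemidef := by
    rw [hD, hS]
    exact posSemidef_sum_smul_siteNumber_sub fun x => δ x - m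
  -- the decomposition `Σ δ_x n_x = m·N̂ + D + S·1`
  have e : (∑ x : Λ₀, ((δ x : ℝ) : ℂ) • (numberOp x 0 + numberOp x 1 : Matrix (Finset (Orb Λ₀)) (Finset (Orb Λ₀)) ℂ)) =
      ((m : ℝ) : ℂ) • totalNumber + D + ((S : ℝ) : ℂ) • (1 : Matrix (Finset (Orb Λ₀)) (Finset (Orb Λ₀)) ℂ) := by
    rw [hD, add_sub_assoc', sub_add_cancel, totalNumber_eq_sum_siteNumber, Finset.smul_sum, ← Finset.sum_add_distrib]
    refine Finset.sum_congr rfl fun x _ => ?_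
    rw [← add_smul, ← Complex.ofReal_add, add_sub_cancel]
  have hN : (totalNumber : Matrix (Finset (Orb Λ₀)) (Finset (Orb Λ₀)) ℂ) *ᵥ ψ = (N : ℂ) • ψ :=
    (LiebTwo.isNParticle_iff_totalNumber N ψ).1 hψN
  have h0 := hDpsd.dotProduct_mulVec_nonneg ψ
  obtain ⟨hre, -⟩ := Complex.nonneg_iff.mp h0
  unfold expect
  rw [e, add_mulVec, add_mulVec, smul_mulVec, hN, smul_mulVec, one_mulVec, dotProduct_add, dotProduct_add, dotProduct_smul,
    dotProduct_smul, dotProduct_smul, hψ1]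
  simp only [Complex.add_re, smul_eq_mul, mul_one, Complex.mul_re, Complex.ofReal_re, Complex.ofReal_im,
    Complex.natCast_re, Complex.natCast_im, mul_zero, sub_zero] at hre ⊢
  linarith

/-- Rayleigh introduction rule: a uniform lower bound on the unit `N`-particle Rayleigh quotients bounds `E₀(H, N)` from below (`N ≤ |ι|`).
[cite: Tasaki2020, §2.1] -/
theorem le_groundEnergy_of_forall_re_expect {ι : Type*} [LinearOrder ι] [Fintype ι] (H : Matrix (Finset ι) (Finset ι) ℂ) {N : ℕ}
    (hN : N ≤ Fintype.card ι) {c : ℝ} (h : ∀ ψ : Fock ι, IsNParticle N ψ → star ψ ⬝ᵥ ψ = 1 → c ≤ (expect H ψ).re) :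
    c ≤ groundEnergy H N := by
  unfold groundEnergy
  refine le_csInf (ThermodynamicLimit.groundEnergySet_nonempty H hN) ?_
  rintro E ⟨ψ, hψN, hψ1, rfl⟩
  exact h ψ hψN hψ1

/-- `⟨ψ, (A + B)ψ⟩ = ⟨ψ, Aψ⟩ + ⟨ψ, Bψ⟩`. [folklore] -/
private theorem expect_add' {ι : Type*} [LinearOrder ι] [Fintype ι] (A B : Matrix (Finset ι) (Finset ι) ℂ) (ψ : Fock ι) :
    expect (A + B) ψ = expect A ψ + expect B ψ := by
  unfold expect
  rw [add_mulVec, dotProduct_add]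

/-- **THE SECTOR RE-TILT.** For every `m ∈ ℝ` and every sector `N ≤ 2|Λ|`:
`E₀(h(τ,υ,ν+δ), N) ≥ E₀(h(τ,υ,ν), N) + m·N + 2Σ_x min(0, δ_x − m)`. With all `δ_x = c` and `m = c` this is the exact shift `c·N`; in general the right
side, optimised over `m`, is the sum of the `N` smallest of the `2|Λ|` numbers `(δ_x, δ_x)_x`. [cite: Tasaki2020, §2.1] [cite: ValentiStolzeHirschfeld1991, §II] -/
theorem groundEnergy_generalPair_retilt_ge (τ : Λ₀ → Λ₀ → ℝ) (υ ν δ : Λ₀ → ℝ) (m : ℝ) {N : ℕ} (hN : N ≤ 2 * Fintype.card Λ₀) :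
    groundEnergy (generalPairHamiltonian τ υ ν) N + (m * N + 2 * ∑ x : Λ₀, min 0 (δ x - m)) ≤
      groundEnergy (generalPairHamiltonian τ υ (ν + δ)) N := by
  refine le_groundEnergy_of_forall_re_expect _ (by rw [card_orb]; exact hN) fun ψ hψN hψ1 => ?_
  rw [generalPairHamiltonian_nu_add, expect_add', Complex.add_re]
  exact add_le_add (LiebThm1.groundEnergy_le_re_expect _ hψN hψ1) (re_expect_sum_smul_siteNumber_ge δ m hψN hψ1)

/-- **Table form**: a sector floor table `σ k ≤ E₀(h(ν), k)` (`k ≤ K ≤ 2|Λ|`) re-tilts to `σ k + (m_k·k + 2Σ_x min(0, δ_x − m_k)) ≤ E₀(h(ν+δ), k)` for ANY per-sector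
choice `m : ℕ → ℝ`. [cite: KullEtAl2024, §5.3] -/
theorem sectorFloors_generalPair_retilt (τ : Λ₀ → Λ₀ → ℝ) (υ ν δ : Λ₀ → ℝ) (m : ℕ → ℝ) {K : ℕ} (hK : K ≤ 2 * Fintype.card Λ₀) {σ : ℕ → ℝ}
    (hσ : ∀ k ≤ K, σ k ≤ groundEnergy (generalPairHamiltonian τ υ ν) k) :
    ∀ k ≤ K, σ k + (m k * k + 2 * ∑ x : Λ₀, min 0 (δ x - m k)) ≤ groundEnergy (generalPairHamiltonian τ υ (ν + δ)) k :=
  fun k hk => (add_le_add (hσ k hk) le_rfl).trans (groundEnergy_generalPair_retilt_ge τ υ ν δ (m k) (hk.trans hK))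

end GeneralPair

/-! ### §2. The uniformly weighted `CuO₄` plus: tables along the level direction, the sector shift, the re-tilted window certificate -/

section Plus

variable (θ : Fin 14 → ℝ) (M c : ℝ)

/-- Along the level direction the PAIR table does not move. [cite: ValentiStolzeHirschfeld1991, §II] -/
theorem plusTau_add_smul_eps : plusTau (θ + c • emeryAtomEps) M = plusTau θ M := by
  funext i j
  simp [plusTau, emeryAtomEps]

/-- Along the level direction the REPULSION table does not move. [cite: ValentiStolzeHirschfeld1991, §II] -/
theorem plusUps_add_smul_eps : plusUps (θ + c • emeryAtomEps) M = plusUps θ M := by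
  funext i
  simp [plusUps, emeryAtomEps]

/-- **The site-energy table along the level direction**: `plusNu (θ + c·ε) M = plusNu θ M + c·M·(½, ½, 1, ½, ½)` (ranks O_x, O_y, Cu, O_y, O_x).
[cite: ValentiStolzeHirschfeld1991, §II] -/
theorem plusNu_add_smul_eps :
    plusNu (θ + c • emeryAtomEps) M = plusNu θ M + fun i => c * M * (![1/2, 1/2, 1, 1/2, 1/2] : Fin 5 → ℝ) (ofLex i).2 := by
  funext i
  simp only [plusNu, Pi.add_apply, Pi.smul_apply, smul_eq_mul, emeryAtomEps]
  generalize (ofLex i).2 = k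
  fin_cases k <;> simp <;> ring

/-- Sums over the ranked plus `Fin 1 ×ₗ Fin 5` are sums over the five ranks. [folklore] -/
private theorem sum_lex_fin_one_five (g : Fin 1 ×ₗ Fin 5 → ℝ) : ∑ i : Fin 1 ×ₗ Fin 5, g i = ∑ j : Fin 5, g (toLex ((0 : Fin 1), j)) := by
  rw [← Fintype.sum_equiv toLex (fun p : Fin 1 × Fin 5 => g (toLex p)) g (fun _ => rfl), Fintype.sum_prod_type]
  simp

/-- The bracket sum of the plus weights `c·M·(½,½,1,½,½)` against a level `r`: `4·min(0, cM/2 − r) + min(0, cM − r)`. [folklore] -/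
private theorem plus_sum_min_weights (r : ℝ) :
    ∑ i : Fin 1 ×ₗ Fin 5, min 0 (c * M * (![1/2, 1/2, 1, 1/2, 1/2] : Fin 5 → ℝ) (ofLex i).2 - r) =
      4 * min 0 (c * M / 2 - r) + min 0 (c * M - r) := by
  rw [sum_lex_fin_one_five]
  simp only [ofLex_toLex, Fin.sum_univ_five, Matrix.cons_val_zero, Matrix.cons_val_one, Matrix.cons_val_two, Matrix.cons_val_three,
    Matrix.cons_val_four, Matrix.head_cons, Matrix.tail_cons, mul_one]
  rw [show c * M * (1 / 2 : ℝ) = c * M / 2 by ring]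
  ring

/-- **THE SECTOR SHIFT OF THE PLUS.** For every `k ≤ 10`:
`E₀(h^G(θ + c·ε), k) ≥ E₀(h^G(θ), k) + max( (cM/2)·k + min(0, cM), cM·k − 4·max(0, cM) )`, `h^G(θ) = hubbardOpenBoxGP 1 5 (plusTau θ M) (plusUps θ M) (plusNu θ M)`
(lowering the level, `c ≤ 0 ≤ M`: loss `(cM/2)(k+2)`; raising it: GAIN `(cM/2)(k + max(0, k−8))`). [cite: Tasaki2020, §2.1] [cite: ValentiStolzeHirschfeld1991, §II] -/
theorem groundEnergy_plusGP_retilt_ge {k : ℕ} (hk : k ≤ 10) :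
    groundEnergy (hubbardOpenBoxGP 1 5 (plusTau θ M) (plusUps θ M) (plusNu θ M)) k +
        max (c * M / 2 * k + min 0 (c * M)) (c * M * k - 4 * max 0 (c * M)) ≤
      groundEnergy (hubbardOpenBoxGP 1 5 (plusTau (θ + c • emeryAtomEps) M) (plusUps (θ + c • emeryAtomEps) M)
        (plusNu (θ + c • emeryAtomEps) M)) k := by
  have hk' : k ≤ 2 * Fintype.card (Fin 1 ×ₗ Fin 5) := by rw [card_rectSites]; omega
  rw [plusTau_add_smul_eps, plusUps_add_smul_eps, plusNu_add_smul_eps, hubbardOpenBoxGP_eq_generalPairHamiltonian,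
    hubbardOpenBoxGP_eq_generalPairHamiltonian]
  have h1 := groundEnergy_generalPair_retilt_ge (plusTau θ M) (plusUps θ M) (plusNu θ M)
    (fun i => c * M * (![1/2, 1/2, 1, 1/2, 1/2] : Fin 5 → ℝ) (ofLex i).2) (c * M / 2) hk'
  have h2 := groundEnergy_generalPair_retilt_ge (plusTau θ M) (plusUps θ M) (plusNu θ M)
    (fun i => c * M * (![1/2, 1/2, 1, 1/2, 1/2] : Fin 5 → ℝ) (ofLex i).2) (c * M) hk'
  rw [plus_sum_min_weights, show c * M / 2 - c * M / 2 = 0 by ring, show c * M - c * M / 2 = c * M / 2 by ring, min_self] at h1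
  rw [plus_sum_min_weights, show c * M / 2 - c * M = -(c * M / 2) by ring, sub_self, min_self] at h2
  refine add_le_of_le_sub_left (max_le ?_ ?_)
  · rcases le_total 0 (c * M) with h | h
    · rw [min_eq_left (by linarith : (0 : ℝ) ≤ c * M / 2)] at h1
      rw [min_eq_left h]
      linarith
    · rw [min_eq_right (by linarith : c * M / 2 ≤ 0)] at h1
      rw [min_eq_right h]
      linarith
  · rcases le_total 0 (c * M) with h | h
    · rw [min_eq_right (by linarith : -(c * M / 2) ≤ 0)] at h2
      rw [max_eq_right h]
      linarith
    · rw [min_eq_left (by linarith : (0 : ℝ) ≤ -(c * M / 2))] at h2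
      rw [max_eq_left h]
      linarith

/-- **THE RE-TILTED SECTOR TABLE**: a floor table `σ k ≤ E₀(h^G(θ), k)` (`k ≤ 10`) at tilt `θ` gives, at tilt `θ + c·ε`, the table
`σ k + max((cM/2)k + min(0,cM), cMk − 4 max(0,cM)) ≤ E₀(h^G(θ + c·ε), k)`. [cite: KullEtAl2024, §5.3] -/
theorem sectorFloors_plusGP_retilt {σ : ℕ → ℝ}
    (hσ : ∀ k ≤ 10, σ k ≤ groundEnergy (hubbardOpenBoxGP 1 5 (plusTau θ M) (plusUps θ M) (plusNu θ M)) k) :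
    ∀ k ≤ 10, σ k + max (c * M / 2 * k + min 0 (c * M)) (c * M * k - 4 * max 0 (c * M)) ≤
      groundEnergy (hubbardOpenBoxGP 1 5 (plusTau (θ + c • emeryAtomEps) M) (plusUps (θ + c • emeryAtomEps) M)
        (plusNu (θ + c • emeryAtomEps) M)) k :=
  fun k hk => (add_le_add (hσ k hk) le_rfl).trans (groundEnergy_plusGP_retilt_ge θ M c hk)

/-- **THE RE-TILTED WINDOW CERTIFICATE FROM A SECTOR TABLE.** A kernel sector table `σ k ≤ E₀(h^G(θ), k)` (`k ≤ 10`) at tilt `θ` and any number `q` with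
`q ≤ σ k + max((cM/2)k + min(0,cM), cMk − 4 max(0,cM))` for all `k ≤ 10` give the window certificate AT TILT `θ + c·ε`:
`H^{w_M}_{W₅}[emeryInteraction (θ + c·ε)] + 0 − q·1 ⪰ 0` — the literal `hq` of `le_emeryEnergyDensity_of_cuO4Certificate` /
`emeryCellPressure_tiltedCorner_le_of_cuO4Certificate` at the new level. [cite: KullEtAl2024, §5.3] [cite: ValentiStolzeHirschfeld1991, §II] -/
theorem posSemidef_cuO4_uniform_retilt_of_sectorFloors {σ : ℕ → ℝ}
    (hσ : ∀ k ≤ 10, σ k ≤ groundEnergy (hubbardOpenBoxGP 1 5 (plusTau θ M) (plusUps θ M) (plusNu θ M)) k) {q : ℝ}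
    (hq : ∀ k ≤ 10, q ≤ σ k + max (c * M / 2 * k + min 0 (c * M)) (c * M * k - 4 * max 0 (c * M))) :
    ((⟨fun X => (uniformPeriodicWeight liebPeriods emeryCuO4Window M X : ℂ) • (emeryInteraction (θ + c • emeryAtomEps)).Φ X⟩ :
        FermionInteraction 2).localHamiltonian emeryCuO4Window + (0 : FermionOp emeryCuO4Window) -
      (q : ℂ) • (1 : FermionOp emeryCuO4Window)).PosSemidef :=
  posSemidef_cuO4_uniform_add_zero_sub_of_gpSectorFloors _ M fun k hk => (hq k hk).trans (sectorFloors_plusGP_retilt θ M c hσ k hk)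

/-- `relabel e 1 = 1` (generic rewriting form). [folklore] -/
private theorem relabel_one_generic' {ι ι' : Type*} [LinearOrder ι] [Fintype ι] [LinearOrder ι'] [Fintype ι']
    (e : ι ≃ ι') : relabel e (1 : Matrix (Finset ι) (Finset ι) ℂ) = 1 :=
  map_one (relabel e)

/-- The flat constant of the plus: `2Σ_i min(0, c·M·wᵢ) = 6M·min(0, c)` for `M ≥ 0` (weights `(½,½,1,½,½)` sum to `3`). [folklore] -/
private theorem plus_flat_retilt_const (hM : 0 ≤ M) :
    2 * ∑ i : Fin 1 ×ₗ Fin 5, min 0 (c * M * (![1/2, 1/2, 1, 1/2, 1/2] : Fin 5 → ℝ) (ofLex i).2) = 6 * M * min 0 c := by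
  have h := plus_sum_min_weights M c 0
  simp only [sub_zero] at h
  rw [h]
  rcases le_total 0 c with hc | hc
  · rw [min_eq_left hc, min_eq_left (by positivity : (0 : ℝ) ≤ c * M / 2), min_eq_left (by positivity : (0 : ℝ) ≤ c * M)]
    ring
  · have h1 : c * M ≤ 0 := mul_nonpos_of_nonpos_of_nonneg hc hM
    rw [min_eq_right hc, min_eq_right (by linarith : c * M / 2 ≤ 0), min_eq_right h1]
    ring

/-- **THE FLAT RE-TILT of a `CuO₄` window certificate** (any multiplier `G`, uniform weight of mass `M ≥ 0`): a certificate at tilt `θ` with constant `q` is a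
certificate at tilt `θ + c·ε` with constant `q + 6M·min(0, c)` (`0 ⪯ N_w ⪯ 6M` for the weighted number of the plus). The sector form above is sharper whenever a
sector table is at hand. [cite: KullEtAl2024, §5.3] [cite: Israel1979, Thm. I.3.4] -/
theorem posSemidef_cuO4_uniform_retilt (hM : 0 ≤ M) {G : FermionOp emeryCuO4Window} {q : ℝ}
    (h : ((⟨fun X => (uniformPeriodicWeight liebPeriods emeryCuO4Window M X : ℂ) • (emeryInteraction θ).Φ X⟩ :
        FermionInteraction 2).localHamiltonian emeryCuO4Window + G - (q : ℂ) • (1 : FermionOp emeryCuO4Window)).PosSemidef) :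
    ((⟨fun X => (uniformPeriodicWeight liebPeriods emeryCuO4Window M X : ℂ) • (emeryInteraction (θ + c • emeryAtomEps)).Φ X⟩ :
        FermionInteraction 2).localHamiltonian emeryCuO4Window + G -
      ((q + 6 * M * min 0 c : ℝ) : ℂ) • (1 : FermionOp emeryCuO4Window)).PosSemidef := by
  set e := Orb.mapEquiv cuO4SiteEquiv with he
  -- transport the hypothesis to the ranked cluster
  have h1 := posSemidef_relabel e h
  rw [map_sub, map_add, map_smul, relabel_one_generic', relabel_cuO4_uniform_emeryInteraction, hubbardOpenBoxGP_eq_generalPairHamiltonian] at h1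
  -- flat re-tilt on the ranked cluster
  have h2 := posSemidef_generalPair_retilt (plusTau θ M) (plusUps θ M) (plusNu θ M)
    (fun i => c * M * (![1/2, 1/2, 1, 1/2, 1/2] : Fin 5 → ℝ) (ofLex i).2) h1
  rw [plus_flat_retilt_const M c hM, ← plusNu_add_smul_eps, ← plusTau_add_smul_eps θ M c, ← plusUps_add_smul_eps θ M c,
    ← hubbardOpenBoxGP_eq_generalPairHamiltonian, ← relabel_cuO4_uniform_emeryInteraction, ← relabel_one_generic' e, ← map_smul, ← map_add,
    ← map_sub] at h2
  have h3 := posSemidef_relabel e.symm h2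
  rw [relabel_symm_relabel] at h3
  exact h3

end Plus

end Literature.MathematicalPhysics.QuantumLattice

end
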